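import Summits.AtomisticToContinuum.HydrodynamicLimit.Theorems.TwoClocksEquilibriumFastWindowLDBirthT12LorentzAngular
import Literature.Analysis.FluidPDE.SphereMeasureSymmetry
import Mathlib.MeasureTheory.Integral.IntervalIntegral.Periodic
import Mathlib.Analysis.SpecialFunctions.Trigonometric.Angle
import HarnessLib

/-!
# Cylindrical coordinates on `S²`: Archimedes' hat-box law WITH AZIMUTH
# (helpers `t12_sphereMeasure_cyl`, `t12_integral_sphere_cyl` of the line `birth`, crux
# `TwoClocks.EquilibriumFastWindowLD`, stmt-AtomisticToContinuum-14440; FF2/Z5-infrastructure towards the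
# registered analytic sub-goal `t12_logLinearPreimage_and_dipoleModulus` — the circle averages `A_z` of FACT F)

The far-field calculus of the corrector-growth plan (§2 FACT F, §4 Z5, §6 FF2) is written in CIRCLE AVERAGES
`(A_z Y)(n) := (2π)⁻¹ ∫_{-π}^{π} Y(z n + √(1-z²)(cos φ e₁ n + sin φ e₂ n)) dφ` over the circle
`{ω ∈ S² : ⟪ω, n⟫ = z}`, and composes them. The tree had the hat-box law for functions of the HEIGHT only
(`t12_sphereMeasure_map_inner`, `lintegral_sphere_comp_inner`: `σ ∘ ⟪n, ·⟫⁻¹ = 2π Leb|_{[-1,1]}`) and the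
flux form in DISC coordinates (`lintegral_toSphere_cos_comp_coords`). This file supplies the full
cylindrical coordinates `(z, φ) = (height, azimuth)` about a unit axis `n ∈ ℝ³`, in the tree's measurable
orthonormal frame `(e₁ n, e₂ n, n)` (`Lambert.e₁/e₂`, `DicedHardSphereDynamics.lean`):

* `lintegral_sphere_cos_mul_eq_cyl` — the flux form with azimuth on the upper hemisphere,
  `∫ ⟪n, ν⟫₊ F(ν) dσ = ∫₀¹ z ∫_{-π}^{π} F(z n + √(1-z²)(cos φ e₁ n + sin φ e₂ n)) dφ dz` (Lambert's flux form,
  polar coordinates in the disc `lintegral_ball_eq_lintegral_polar`, and the radial swap `ρ = √(1-z²)`,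
  `ρ dρ = z dz`, `lintegral_Ioo_mul_comp_sqrt_one_sub_sq`);
* `lintegral_sphere_eq_cyl` (registered as `t12_sphereMeasure_cyl`) — **`dσ = dz dφ` on `(-1,1) × (-π,π)`**
  for every measurable `F ≥ 0`: upper hemisphere by testing the flux form against `F/⟪n, ν⟫`, lower
  hemisphere by the antipodal symmetry of `σ` (`measurePreserving_neg_sphere`), the substitution `z ↦ -z`
  and the AZIMUTH FLIP `φ ↦ φ + π` (`lintegral_Ioc_cos_sin_antipodal`: Haar measure of the circle `ℝ/2πℤ`,
  `AddCircle.lintegral_preimage`, `Real.Angle.cos_add_pi`); the equator is null (`sphereMeasure_inner_eq_zero`);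
* `sphereMeasure_map_coe_eq_map_cylPoint` — the same as an identity of measures on `ℝ³`
  (`σ ∘ ι⁻¹ = Leb|_{(-1,1)×(-π,π)} ∘ cyl⁻¹`, `cyl (z, φ)` the point of height `z` and azimuth `φ`),
  whence the Bochner forms `integral_sphere_eq_integral_cylPoint` (Banach values, no integrability),
  the integrability transfer `integrableOn_comp_cylPoint_iff` and the iterated form `integral_sphere_eq_cyl`
  (registered real-valued as `t12_integral_sphere_cyl`);
* geometry of the circle points: `inner_self_cylPoint` (`⟪n, ·⟫ = z`), `norm_cylPoint` (unit norm).

NOT here: the circle-average form of the Lorentz operator and the Funk–Hecke formula for circles (sibling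
file `…T12LorentzCircleAvg`). All statements are [folklore] (Archimedes, *On the Sphere and Cylinder* I).
-/

noncomputable section

open MeasureTheory Real Set Filter Metric
open scoped ENNReal BigOperators InnerProductSpace
namespace Summit.AtomisticToContinuum.HydrodynamicLimit.Theorems.ClampedCorrectorBirth

open Literature.Analysis.FluidPDE Literature.MathematicalPhysics.KineticTheory Literature.Analysis.Calculus

/-! ### The circle of height `z` about a unit axis `n` -/

/-- The height of the circle point: `⟪n, z n + √(1-z²)(cos φ e₁ n + sin φ e₂ n)⟫ = z` (unit `n`). [folklore] -/
theorem inner_self_cylPoint {n : EuclideanSpace ℝ (Fin 3)} (hn : ‖n‖ = 1) (z φ : ℝ) :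
    ⟪n, z • n + √(1 - z ^ 2) • (cos φ • Lambert.e₁ n + sin φ • Lambert.e₂ n)⟫_ℝ = z := by
  rw [inner_add_right, inner_smul_right, inner_smul_right, inner_add_right, inner_smul_right,
    inner_smul_right, Lambert.inner_self_e₁, Lambert.inner_self_e₂, real_inner_self_eq_norm_sq, hn]
  ring

/-- The circle point is a unit vector: `‖z n + √(1-z²)(cos φ e₁ n + sin φ e₂ n)‖ = 1` for `z² ≤ 1`
(unit `n`; `(e₁ n, e₂ n, n)` is orthonormal). [folklore] -/
theorem norm_cylPoint {n : EuclideanSpace ℝ (Fin 3)} (hn : ‖n‖ = 1) {z : ℝ} (hz : z ^ 2 ≤ 1) (φ : ℝ) :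
    ‖z • n + √(1 - z ^ 2) • (cos φ • Lambert.e₁ n + sin φ • Lambert.e₂ n)‖ = 1 := by
  have hc : ‖cos φ • Lambert.e₁ n + sin φ • Lambert.e₂ n‖ ^ 2 = 1 := by
    rw [norm_add_sq_real, norm_smul, norm_smul, Lambert.norm_e₁, Lambert.norm_e₂ hn, real_inner_smul_left,
      real_inner_smul_right, Lambert.inner_e₁_e₂, Real.norm_eq_abs, Real.norm_eq_abs, mul_one, mul_one,
      sq_abs, sq_abs, mul_zero, mul_zero, mul_zero, add_zero, cos_sq_add_sin_sq]
  have hperp : ⟪z • n, √(1 - z ^ 2) • (cos φ • Lambert.e₁ n + sin φ • Lambert.e₂ n)⟫_ℝ = 0 := by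
    rw [real_inner_smul_left, real_inner_smul_right, inner_add_right, inner_smul_right, inner_smul_right,
      Lambert.inner_self_e₁, Lambert.inner_self_e₂, mul_zero, mul_zero, add_zero, mul_zero, mul_zero]
  have key : ‖z • n + √(1 - z ^ 2) • (cos φ • Lambert.e₁ n + sin φ • Lambert.e₂ n)‖ ^ 2 = 1 := by
    rw [norm_add_sq_real, hperp, norm_smul, norm_smul, mul_pow, mul_pow, hc, hn, Real.norm_eq_abs,
      Real.norm_eq_abs, sq_abs, sq_abs, sq_sqrt (by linarith)]
    ring
  exact (pow_left_inj₀ (norm_nonneg _) zero_le_one two_ne_zero).1 (by rw [key, one_pow])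

/-! ### The azimuth flip `φ ↦ φ + π` -/

/-- **The azimuth flip**: `∫_{-π}^{π} G(-cos φ, -sin φ) dφ = ∫_{-π}^{π} G(cos φ, sin φ) dφ` for every
`G ≥ 0` — translation invariance of the Haar measure of the circle `ℝ/2πℤ` under `θ ↦ θ + π`
(`AddCircle.lintegral_preimage`, `Real.Angle.cos_add_pi`). [folklore] -/
theorem lintegral_Ioc_cos_sin_antipodal (G : ℝ → ℝ → ℝ≥0∞) :
    ∫⁻ φ in Ioc (-π) π, G (-cos φ) (-sin φ) = ∫⁻ φ in Ioc (-π) π, G (cos φ) (sin φ) := by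
  haveI : Fact (0 < 2 * π) := ⟨by positivity⟩
  have key : ∀ H : AddCircle (2 * π) → ℝ≥0∞, ∫⁻ φ in Ioc (-π) π, H (φ : AddCircle (2 * π)) =
      ∫⁻ θ : AddCircle (2 * π), H θ := fun H => by
    have h := AddCircle.lintegral_preimage (2 * π) (-π) H
    rwa [show -π + 2 * π = π by ring] at h
  have hc : ∀ φ : ℝ, Real.Angle.cos ((φ : AddCircle (2 * π))) = Real.cos φ := fun φ => Real.Angle.cos_coe φ
  have hs : ∀ φ : ℝ, Real.Angle.sin ((φ : AddCircle (2 * π))) = Real.sin φ := fun φ => Real.Angle.sin_coe φ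
  have h1 := key fun θ => G (-Real.Angle.cos θ) (-Real.Angle.sin θ)
  have h2 := key fun θ => G (Real.Angle.cos θ) (Real.Angle.sin θ)
  simp only [hc, hs] at h1 h2
  rw [h1, h2, ← lintegral_add_right_eq_self (μ := (volume : Measure (AddCircle (2 * π))))
    (fun θ : AddCircle (2 * π) => G (Real.Angle.cos θ) (Real.Angle.sin θ)) ((π : ℝ) : AddCircle (2 * π))]
  refine lintegral_congr fun θ => ?_
  have h3 : Real.Angle.cos (θ + ((π : ℝ) : AddCircle (2 * π))) = -Real.Angle.cos θ := Real.Angle.cos_add_pi θ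
  have h4 : Real.Angle.sin (θ + ((π : ℝ) : AddCircle (2 * π))) = -Real.Angle.sin θ := Real.Angle.sin_add_pi θ
  rw [h3, h4]

/-! ### Cylindrical coordinates on the sphere: the hat-box law with azimuth -/

/-- **The flux form of the hat-box law with azimuth** (upper hemisphere): for a unit vector `n` and
measurable `F ≥ 0` on `ℝ³`,
`∫_{S²} ⟪n, ν⟫₊ F(ν) dσ(ν) = ∫₀¹ z ∫_{-π}^{π} F(z n + √(1-z²)(cos φ e₁ n + sin φ e₂ n)) dφ dz`.
Proof: Lambert's flux form `lintegral_toSphere_cos_comp_coords` (the tangential coordinates are Lebesgue on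
the unit disc), polar coordinates in the disc, and the radial swap `ρ = √(1-z²)` (`ρ dρ = z dz`). [folklore] -/
theorem lintegral_sphere_cos_mul_eq_cyl {n : EuclideanSpace ℝ (Fin 3)} (hn : ‖n‖ = 1)
    {F : EuclideanSpace ℝ (Fin 3) → ℝ≥0∞} (hF : Measurable F) :
    ∫⁻ ν : sphere (0 : EuclideanSpace ℝ (Fin 3)) 1,
        ENNReal.ofReal ⟪n, (ν : EuclideanSpace ℝ (Fin 3))⟫_ℝ * F ν ∂sphereMeasure =
      ∫⁻ z in Ioo (0:ℝ) 1, ENNReal.ofReal z * ∫⁻ φ in Ioo (-π) π,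
        F (z • n + √(1 - z ^ 2) • (cos φ • Lambert.e₁ n + sin φ • Lambert.e₂ n)) := by
  have h1 : ∀ ν : sphere (0 : EuclideanSpace ℝ (Fin 3)) 1,
      ENNReal.ofReal ⟪n, (ν : EuclideanSpace ℝ (Fin 3))⟫_ℝ * F ν =
        ENNReal.ofReal ⟪n, (ν : EuclideanSpace ℝ (Fin 3))⟫_ℝ * F (Lambert.lift n (Lambert.coords n ν)) := by
    intro ν
    rcases le_or_gt ⟪n, (ν : EuclideanSpace ℝ (Fin 3))⟫_ℝ 0 with hle | hpos
    · rw [ENNReal.ofReal_of_nonpos hle, zero_mul, zero_mul]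
    · rw [Lambert.lift_coords hn (by simp) hpos.le]
  have hm : Measurable fun p => F (Lambert.lift n p) := hF.comp (Lambert.measurable_lift n)
  have key := lintegral_Ioo_mul_comp_sqrt_one_sub_sq fun r => ∫⁻ φ in Ioo (-π) π,
    F (r • n + √(1 - r ^ 2) • (cos φ • Lambert.e₁ n + sin φ • Lambert.e₂ n))
  calc ∫⁻ ν : sphere (0 : EuclideanSpace ℝ (Fin 3)) 1,
        ENNReal.ofReal ⟪n, (ν : EuclideanSpace ℝ (Fin 3))⟫_ℝ * F ν ∂sphereMeasure
      = ∫⁻ p in ball (0 : EuclideanSpace ℝ (Fin 2)) 1, F (Lambert.lift n p) := by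
        rw [lintegral_congr h1]
        exact lintegral_toSphere_cos_comp_coords hn hm
    _ = ∫⁻ ρ in Ioo (0:ℝ) 1, ENNReal.ofReal ρ * ∫⁻ φ in Ioo (-π) π,
          F (√(1 - ρ ^ 2) • n + √(1 - √(1 - ρ ^ 2) ^ 2) • (cos φ • Lambert.e₁ n + sin φ • Lambert.e₂ n)) := by
        rw [lintegral_ball_eq_lintegral_polar hm]
        refine setLIntegral_congr_fun measurableSet_Ioo fun ρ hρ => ?_
        have hσ : √(1 - ρ ^ 2) ^ 2 = 1 - ρ ^ 2 := sq_sqrt (by nlinarith [hρ.1, hρ.2])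
        have hτ : √(1 - (1 - ρ ^ 2)) = ρ := by rw [sub_sub_cancel, sqrt_sq hρ.1.le]
        rw [hσ, hτ]
        congr 1
        refine lintegral_congr fun φ => ?_
        rw [Lambert.lift, norm_toLp_polar hρ.1.le, embed_toLp_vec_polar, add_comm]
    _ = _ := key

/-- **Cylindrical coordinates on `S²` (Archimedes' hat-box law with azimuth).** For a unit vector `n` of
`ℝ³` and measurable `F ≥ 0` on `ℝ³`,
`∫_{S²} F(ν) dσ(ν) = ∫_{-1}^{1} ∫_{-π}^{π} F(z n + √(1-z²)(cos φ e₁ n + sin φ e₂ n)) dφ dz`: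
the height `z = ⟪n, ν⟫` and the azimuth `φ` of a uniform point of the sphere are independent and uniform
(`dσ = dz dφ`). Upper hemisphere: the flux form tested against `F(ν)/⟪n, ν⟫`; lower hemisphere: the
antipodal symmetry of `σ` (`measurePreserving_neg_sphere`), the azimuth flip and `z ↦ -z`; the equator is
`σ`-null (`sphereMeasure_inner_eq_zero`). [folklore] -/
theorem lintegral_sphere_eq_cyl {n : EuclideanSpace ℝ (Fin 3)} (hn : ‖n‖ = 1)
    {F : EuclideanSpace ℝ (Fin 3) → ℝ≥0∞} (hF : Measurable F) :
    ∫⁻ ν : sphere (0 : EuclideanSpace ℝ (Fin 3)) 1, F ν ∂sphereMeasure =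
      ∫⁻ z in Ioo (-1:ℝ) 1, ∫⁻ φ in Ioo (-π) π,
        F (z • n + √(1 - z ^ 2) • (cos φ • Lambert.e₁ n + sin φ • Lambert.e₂ n)) := by
  have hn0 : n ≠ 0 := fun h => by rw [h, norm_zero] at hn; exact zero_ne_one hn
  have hφ := measurable_sphere_inner n
  -- upper hemisphere, for every measurable `G`
  have hup : ∀ G : EuclideanSpace ℝ (Fin 3) → ℝ≥0∞, Measurable G →
      ∫⁻ ν : sphere (0 : EuclideanSpace ℝ (Fin 3)) 1,
          (Ioi (0:ℝ)).indicator (fun _ => (1:ℝ≥0∞)) ⟪n, (ν : EuclideanSpace ℝ (Fin 3))⟫_ℝ * G ν ∂sphereMeasure =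
        ∫⁻ z in Ioo (0:ℝ) 1, ∫⁻ φ in Ioo (-π) π,
          G (z • n + √(1 - z ^ 2) • (cos φ • Lambert.e₁ n + sin φ • Lambert.e₂ n)) := by
    intro G hG
    have hm : Measurable fun x : EuclideanSpace ℝ (Fin 3) => (ENNReal.ofReal ⟪n, x⟫_ℝ)⁻¹ * G x :=
      ((measurable_const.inner measurable_id).ennreal_ofReal.inv).mul hG
    have hpt : ∀ ν : sphere (0 : EuclideanSpace ℝ (Fin 3)) 1,
        (Ioi (0:ℝ)).indicator (fun _ => (1:ℝ≥0∞)) ⟪n, (ν : EuclideanSpace ℝ (Fin 3))⟫_ℝ * G ν =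
          ENNReal.ofReal ⟪n, (ν : EuclideanSpace ℝ (Fin 3))⟫_ℝ *
            ((ENNReal.ofReal ⟪n, (ν : EuclideanSpace ℝ (Fin 3))⟫_ℝ)⁻¹ * G ν) := by
      intro ν
      rcases le_or_gt ⟪n, (ν : EuclideanSpace ℝ (Fin 3))⟫_ℝ 0 with hle | hpos
      · rw [ENNReal.ofReal_of_nonpos hle, zero_mul,
          indicator_of_notMem (fun h : ⟪n, (ν : EuclideanSpace ℝ (Fin 3))⟫_ℝ ∈ Ioi (0:ℝ) =>
            (not_lt.2 hle) (mem_Ioi.1 h)), zero_mul]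
      · rw [← mul_assoc, ENNReal.mul_inv_cancel (ENNReal.ofReal_pos.2 hpos).ne' ENNReal.ofReal_ne_top,
          indicator_of_mem (mem_Ioi.2 hpos), one_mul]
    rw [lintegral_congr hpt, lintegral_sphere_cos_mul_eq_cyl hn hm]
    refine setLIntegral_congr_fun measurableSet_Ioo fun z hz => ?_
    rw [← lintegral_const_mul' _ _ ENNReal.ofReal_ne_top]
    refine lintegral_congr fun φ => ?_
    rw [inner_self_cylPoint hn, ← mul_assoc,
      ENNReal.mul_inv_cancel (ENNReal.ofReal_pos.2 hz.1).ne' ENNReal.ofReal_ne_top, one_mul]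
  -- lower hemisphere
  have hdown : ∫⁻ ν : sphere (0 : EuclideanSpace ℝ (Fin 3)) 1,
      (Ioi (0:ℝ)).indicator (fun _ => (1:ℝ≥0∞)) (-⟪n, (ν : EuclideanSpace ℝ (Fin 3))⟫_ℝ) * F ν ∂sphereMeasure =
        ∫⁻ z in Ioo (-1:ℝ) 0, ∫⁻ φ in Ioo (-π) π,
          F (z • n + √(1 - z ^ 2) • (cos φ • Lambert.e₁ n + sin φ • Lambert.e₂ n)) := by
    have hmeas : Measurable fun ν : sphere (0 : EuclideanSpace ℝ (Fin 3)) 1 =>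
        (Ioi (0:ℝ)).indicator (fun _ => (1:ℝ≥0∞)) ⟪n, (ν : EuclideanSpace ℝ (Fin 3))⟫_ℝ *
          F (-(ν : EuclideanSpace ℝ (Fin 3))) :=
      ((measurable_const.indicator measurableSet_Ioi).comp hφ).mul
        (hF.comp measurable_subtype_coe.neg)
    have h1 := (measurePreserving_neg_sphere (E := EuclideanSpace ℝ (Fin 3))).lintegral_comp hmeas
    simp only [coe_neg_sphere, inner_neg_right, neg_neg] at h1
    have h3 := hup (fun x => F (-x)) (hF.comp measurable_neg)
    beta_reduce at h3
    rw [h1, h3]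
    have h2 : ∀ z : ℝ, ∫⁻ φ in Ioo (-π) π,
        F (-(z • n + √(1 - z ^ 2) • (cos φ • Lambert.e₁ n + sin φ • Lambert.e₂ n))) =
        ∫⁻ φ in Ioo (-π) π,
          F ((-z) • n + √(1 - (-z) ^ 2) • (cos φ • Lambert.e₁ n + sin φ • Lambert.e₂ n)) := by
      intro z
      rw [neg_sq, setLIntegral_congr Ioo_ae_eq_Ioc, setLIntegral_congr Ioo_ae_eq_Ioc,
        ← lintegral_Ioc_cos_sin_antipodal (fun x y =>
          F ((-z) • n + √(1 - z ^ 2) • (x • Lambert.e₁ n + y • Lambert.e₂ n)))]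
      refine lintegral_congr fun φ => ?_
      congr 1
      module
    simp_rw [h2]
    have himage : Ioo (-1 : ℝ) 0 = Neg.neg '' Ioo (0 : ℝ) 1 := by rw [Set.image_neg_Ioo, neg_zero]
    rw [himage, lintegral_image_eq_lintegral_abs_deriv_mul measurableSet_Ioo
      (fun x _ => (hasDerivWithinAt_neg x (Ioo (0 : ℝ) 1))) (fun x _ y _ h => neg_injective h)]
    refine setLIntegral_congr_fun measurableSet_Ioo fun z _ => ?_
    rw [abs_neg, abs_one, ENNReal.ofReal_one, one_mul]
  -- the equator is null
  have hzero : ∫⁻ ν : sphere (0 : EuclideanSpace ℝ (Fin 3)) 1,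
      ({(0:ℝ)} : Set ℝ).indicator (fun _ => (1:ℝ≥0∞)) ⟪n, (ν : EuclideanSpace ℝ (Fin 3))⟫_ℝ * F ν ∂sphereMeasure = 0 := by
    have hs0 : MeasurableSet {ν : sphere (0 : EuclideanSpace ℝ (Fin 3)) 1 |
        ⟪n, (ν : EuclideanSpace ℝ (Fin 3))⟫_ℝ = 0} := hφ (measurableSet_singleton 0)
    have h0 : (fun ν : sphere (0 : EuclideanSpace ℝ (Fin 3)) 1 =>
        ({(0:ℝ)} : Set ℝ).indicator (fun _ => (1:ℝ≥0∞)) ⟪n, (ν : EuclideanSpace ℝ (Fin 3))⟫_ℝ * F ν) =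
        {ν : sphere (0 : EuclideanSpace ℝ (Fin 3)) 1 | ⟪n, (ν : EuclideanSpace ℝ (Fin 3))⟫_ℝ = 0}.indicator
          fun ν => F ν := by
      funext ν
      by_cases h : ⟪n, (ν : EuclideanSpace ℝ (Fin 3))⟫_ℝ = 0
      · rw [indicator_of_mem (mem_singleton_iff.2 h), indicator_of_mem (by simpa using h), one_mul]
      · rw [indicator_of_notMem (fun h' => h (mem_singleton_iff.1 h')),
          indicator_of_notMem (by simpa using h), zero_mul]
    rw [h0, lintegral_indicator hs0, setLIntegral_measure_zero _ _ (sphereMeasure_inner_eq_zero hn0)]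
  -- assembly
  have hsplit : ∀ ν : sphere (0 : EuclideanSpace ℝ (Fin 3)) 1, F ν =
      (Ioi (0:ℝ)).indicator (fun _ => (1:ℝ≥0∞)) ⟪n, (ν : EuclideanSpace ℝ (Fin 3))⟫_ℝ * F ν +
        (Ioi (0:ℝ)).indicator (fun _ => (1:ℝ≥0∞)) (-⟪n, (ν : EuclideanSpace ℝ (Fin 3))⟫_ℝ) * F ν +
          ({(0:ℝ)} : Set ℝ).indicator (fun _ => (1:ℝ≥0∞)) ⟪n, (ν : EuclideanSpace ℝ (Fin 3))⟫_ℝ * F ν := by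
    intro ν
    rcases lt_trichotomy ⟪n, (ν : EuclideanSpace ℝ (Fin 3))⟫_ℝ 0 with hc | hc | hc
    · rw [indicator_of_notMem (fun h : _ ∈ Ioi (0:ℝ) => (not_lt.2 hc.le) (mem_Ioi.1 h)),
        indicator_of_mem (mem_Ioi.2 (neg_pos.2 hc)),
        indicator_of_notMem (fun h : _ ∈ ({(0:ℝ)} : Set ℝ) => hc.ne (mem_singleton_iff.1 h))]
      simp
    · rw [hc, neg_zero, indicator_of_notMem (fun h : (0:ℝ) ∈ Ioi (0:ℝ) => lt_irrefl _ (mem_Ioi.1 h)),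
        indicator_of_mem (mem_singleton _)]
      simp
    · rw [indicator_of_mem (mem_Ioi.2 hc),
        indicator_of_notMem (fun h : _ ∈ Ioi (0:ℝ) => (not_lt.2 (neg_nonpos.2 hc.le)) (mem_Ioi.1 h)),
        indicator_of_notMem (fun h : _ ∈ ({(0:ℝ)} : Set ℝ) => hc.ne' (mem_singleton_iff.1 h))]
      simp
  have hmF : Measurable fun ν : sphere (0 : EuclideanSpace ℝ (Fin 3)) 1 => F ν := hF.comp measurable_subtype_coe
  have hm1 : Measurable fun ν : sphere (0 : EuclideanSpace ℝ (Fin 3)) 1 =>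
      (Ioi (0:ℝ)).indicator (fun _ => (1:ℝ≥0∞)) ⟪n, (ν : EuclideanSpace ℝ (Fin 3))⟫_ℝ * F ν :=
    ((measurable_const.indicator measurableSet_Ioi).comp hφ).mul hmF
  have hm3 : Measurable fun ν : sphere (0 : EuclideanSpace ℝ (Fin 3)) 1 =>
      ({(0:ℝ)} : Set ℝ).indicator (fun _ => (1:ℝ≥0∞)) ⟪n, (ν : EuclideanSpace ℝ (Fin 3))⟫_ℝ * F ν :=
    ((measurable_const.indicator (measurableSet_singleton 0)).comp hφ).mul hmF
  calc ∫⁻ ν : sphere (0 : EuclideanSpace ℝ (Fin 3)) 1, F ν ∂sphereMeasure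
      = (∫⁻ ν : sphere (0 : EuclideanSpace ℝ (Fin 3)) 1,
          (Ioi (0:ℝ)).indicator (fun _ => (1:ℝ≥0∞)) ⟪n, (ν : EuclideanSpace ℝ (Fin 3))⟫_ℝ * F ν ∂sphereMeasure) +
        (∫⁻ ν : sphere (0 : EuclideanSpace ℝ (Fin 3)) 1,
          (Ioi (0:ℝ)).indicator (fun _ => (1:ℝ≥0∞)) (-⟪n, (ν : EuclideanSpace ℝ (Fin 3))⟫_ℝ) * F ν ∂sphereMeasure) +
        ∫⁻ ν : sphere (0 : EuclideanSpace ℝ (Fin 3)) 1,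
          ({(0:ℝ)} : Set ℝ).indicator (fun _ => (1:ℝ≥0∞)) ⟪n, (ν : EuclideanSpace ℝ (Fin 3))⟫_ℝ * F ν ∂sphereMeasure := by
        rw [← lintegral_add_left hm1, ← lintegral_add_right _ hm3]
        exact lintegral_congr hsplit
    _ = (∫⁻ z in Ioo (-1:ℝ) 0, ∫⁻ φ in Ioo (-π) π,
          F (z • n + √(1 - z ^ 2) • (cos φ • Lambert.e₁ n + sin φ • Lambert.e₂ n))) +
        ∫⁻ z in Ioo (0:ℝ) 1, ∫⁻ φ in Ioo (-π) π,
          F (z • n + √(1 - z ^ 2) • (cos φ • Lambert.e₁ n + sin φ • Lambert.e₂ n)) := by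
        rw [hup F hF, hdown, hzero, add_zero, add_comm]
    _ = _ := by
        rw [setLIntegral_congr (Ioo_ae_eq_Ioc : Ioo (-1:ℝ) 0 =ᵐ[volume] Ioc (-1) 0),
          ← lintegral_union measurableSet_Ioo
            (Set.disjoint_left.2 fun x hx hx' => (not_lt.2 hx.2) hx'.1),
          Ioc_union_Ioo_eq_Ioo (by norm_num) (by norm_num)]

/-! ### Measure and Bochner forms -/

/-- The cylindrical parametrisation `(z, φ) ↦ z n + √(1-z²)(cos φ e₁ n + sin φ e₂ n)` of `ℝ × ℝ → ℝ³`
is measurable. [folklore] -/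
theorem measurable_cylPoint (n : EuclideanSpace ℝ (Fin 3)) :
    Measurable fun q : ℝ × ℝ => q.1 • n + √(1 - q.1 ^ 2) • (cos q.2 • Lambert.e₁ n + sin q.2 • Lambert.e₂ n) := by
  fun_prop

/-- **Cylindrical coordinates as an identity of measures**: for unit `n`, the image in `ℝ³` of the
surface measure `σ` of `S²` is the image of Lebesgue measure on the rectangle `(-1, 1) × (-π, π)` under
`(z, φ) ↦ z n + √(1-z²)(cos φ e₁ n + sin φ e₂ n)` (`lintegral_sphere_eq_cyl` on indicators, Tonelli). [folklore] -/
theorem sphereMeasure_map_coe_eq_map_cylPoint {n : EuclideanSpace ℝ (Fin 3)} (hn : ‖n‖ = 1) :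
    (sphereMeasure : Measure (sphere (0 : EuclideanSpace ℝ (Fin 3)) 1)).map
        ((↑) : sphere (0 : EuclideanSpace ℝ (Fin 3)) 1 → EuclideanSpace ℝ (Fin 3)) =
      (volume.restrict (Ioo (-1:ℝ) 1 ×ˢ Ioo (-π) π)).map
        (fun q : ℝ × ℝ => q.1 • n + √(1 - q.1 ^ 2) • (cos q.2 • Lambert.e₁ n + sin q.2 • Lambert.e₂ n)) := by
  ext s hs
  have h1 : ∀ ν : sphere (0 : EuclideanSpace ℝ (Fin 3)) 1,
      (((↑) : sphere (0 : EuclideanSpace ℝ (Fin 3)) 1 → EuclideanSpace ℝ (Fin 3)) ⁻¹' s).indicator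
        (1 : sphere (0 : EuclideanSpace ℝ (Fin 3)) 1 → ℝ≥0∞) ν =
        s.indicator (1 : EuclideanSpace ℝ (Fin 3) → ℝ≥0∞) (ν : EuclideanSpace ℝ (Fin 3)) := fun ν =>
    indicator_comp_right ((↑) : sphere (0 : EuclideanSpace ℝ (Fin 3)) 1 → EuclideanSpace ℝ (Fin 3))
      (g := (1 : EuclideanSpace ℝ (Fin 3) → ℝ≥0∞))
  have h2 : ∀ q : ℝ × ℝ, ((fun q : ℝ × ℝ => q.1 • n + √(1 - q.1 ^ 2) • (cos q.2 • Lambert.e₁ n + sin q.2 • Lambert.e₂ n)) ⁻¹' s).indicator (1 : ℝ × ℝ → ℝ≥0∞) q =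
      s.indicator (1 : EuclideanSpace ℝ (Fin 3) → ℝ≥0∞)
        (q.1 • n + √(1 - q.1 ^ 2) • (cos q.2 • Lambert.e₁ n + sin q.2 • Lambert.e₂ n)) := fun q =>
    indicator_comp_right (fun q : ℝ × ℝ => q.1 • n + √(1 - q.1 ^ 2) • (cos q.2 • Lambert.e₁ n + sin q.2 • Lambert.e₂ n))
      (g := (1 : EuclideanSpace ℝ (Fin 3) → ℝ≥0∞))
  have hm : Measurable fun q : ℝ × ℝ => s.indicator (1 : EuclideanSpace ℝ (Fin 3) → ℝ≥0∞)
      (q.1 • n + √(1 - q.1 ^ 2) • (cos q.2 • Lambert.e₁ n + sin q.2 • Lambert.e₂ n)) :=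
    (measurable_one.indicator hs).comp (measurable_cylPoint n)
  rw [Measure.map_apply measurable_subtype_coe hs, Measure.map_apply (measurable_cylPoint n) hs,
    ← lintegral_indicator_one (measurable_subtype_coe hs), ← lintegral_indicator_one (measurable_cylPoint n hs)]
  simp_rw [h1, h2]
  rw [lintegral_sphere_eq_cyl hn (measurable_one.indicator hs), Measure.volume_eq_prod, ← Measure.prod_restrict,
    lintegral_prod _ hm.aemeasurable]

/-- **Cylindrical coordinates, Bochner form**: for unit `n` and strongly measurable `f` on `ℝ³` (Banach
values, no integrability needed): `∫_{S²} f dσ = ∫_{(-1,1)×(-π,π)} f(z n + √(1-z²)(cos φ e₁ n + sin φ e₂ n)) d(z, φ)`.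
[folklore] -/
theorem integral_sphere_eq_integral_cylPoint {n : EuclideanSpace ℝ (Fin 3)} (hn : ‖n‖ = 1) {G : Type*}
    [NormedAddCommGroup G] [NormedSpace ℝ G] {f : EuclideanSpace ℝ (Fin 3) → G} (hf : StronglyMeasurable f) :
    ∫ ν : sphere (0 : EuclideanSpace ℝ (Fin 3)) 1, f ν ∂sphereMeasure =
      ∫ q in Ioo (-1:ℝ) 1 ×ˢ Ioo (-π) π, f (q.1 • n + √(1 - q.1 ^ 2) • (cos q.2 • Lambert.e₁ n + sin q.2 • Lambert.e₂ n)) := by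
  rw [← integral_map measurable_subtype_coe.aemeasurable hf.aestronglyMeasurable,
    sphereMeasure_map_coe_eq_map_cylPoint hn, integral_map (measurable_cylPoint n).aemeasurable hf.aestronglyMeasurable]

/-- Integrability transfer: `f ∘ cylPoint n` is integrable on the rectangle iff `f` is integrable on the
sphere (unit `n`, `f` strongly measurable). [folklore] -/
theorem integrableOn_comp_cylPoint_iff {n : EuclideanSpace ℝ (Fin 3)} (hn : ‖n‖ = 1) {G : Type*}
    [NormedAddCommGroup G] {f : EuclideanSpace ℝ (Fin 3) → G} (hf : StronglyMeasurable f) :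
    IntegrableOn (fun q : ℝ × ℝ => f (q.1 • n + √(1 - q.1 ^ 2) • (cos q.2 • Lambert.e₁ n + sin q.2 • Lambert.e₂ n)))
        (Ioo (-1:ℝ) 1 ×ˢ Ioo (-π) π) ↔
      Integrable (fun ν : sphere (0 : EuclideanSpace ℝ (Fin 3)) 1 => f ν) sphereMeasure := by
  rw [IntegrableOn, ← Function.comp_def f (fun q : ℝ × ℝ => q.1 • n + √(1 - q.1 ^ 2) • (cos q.2 • Lambert.e₁ n + sin q.2 • Lambert.e₂ n)),
    ← integrable_map_measure hf.aestronglyMeasurable (measurable_cylPoint n).aemeasurable,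
    ← sphereMeasure_map_coe_eq_map_cylPoint hn,
    integrable_map_measure hf.aestronglyMeasurable measurable_subtype_coe.aemeasurable]
  rfl

/-- **Cylindrical coordinates, iterated form**: for unit `n`, `f : ℝ³ → G` strongly measurable and
integrable on the sphere: `∫_{S²} f dσ = ∫_{z ∈ (-1,1)} ∫_{φ ∈ (-π,π)} f(z n + √(1-z²)(cos φ e₁ n + sin φ e₂ n)) dφ dz`
— the inner integral is `2π` times the CIRCLE AVERAGE `(A_z f)(n)` of FACT F. [folklore] -/
theorem integral_sphere_eq_cyl {n : EuclideanSpace ℝ (Fin 3)} (hn : ‖n‖ = 1) {G : Type*}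
    [NormedAddCommGroup G] [NormedSpace ℝ G] {f : EuclideanSpace ℝ (Fin 3) → G} (hf : StronglyMeasurable f)
    (hi : Integrable (fun ν : sphere (0 : EuclideanSpace ℝ (Fin 3)) 1 => f ν) sphereMeasure) :
    ∫ ν : sphere (0 : EuclideanSpace ℝ (Fin 3)) 1, f ν ∂sphereMeasure =
      ∫ z in Ioo (-1:ℝ) 1, ∫ φ in Ioo (-π) π,
        f (z • n + √(1 - z ^ 2) • (cos φ • Lambert.e₁ n + sin φ • Lambert.e₂ n)) := by
  have h := (integrableOn_comp_cylPoint_iff hn hf).2 hi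
  rw [IntegrableOn, Measure.volume_eq_prod] at h
  rw [integral_sphere_eq_integral_cylPoint hn hf, Measure.volume_eq_prod, setIntegral_prod _ h]


/-! ### Registered helpers -/

/-- **Registered helper `t12_sphereMeasure_cyl` — cylindrical coordinates on `S²` (Archimedes' hat-box law
with azimuth), `lintegral` form.** For a unit vector `n` of `ℝ³`, the tree's measurable orthonormal frame
`(e₁ n, e₂ n, n)` (`Lambert.e₁/e₂`) and every measurable `F ≥ 0` on `ℝ³`:
`∫_{S²} F(ν) dσ(ν) = ∫_{z ∈ (-1,1)} ∫_{φ ∈ (-π,π)} F(z n + √(1-z²)(cos φ e₁ n + sin φ e₂ n)) dφ dz` — under the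
surface measure `σ` (`sphereMeasure`, mass `4π`) the height `z = ⟪n, ν⟫` and the azimuth `φ` are independent
and uniform, `dσ = dz dφ`. The inner integral is `2π (A_z F)(n)`, the circle average of FACT F of the
corrector-growth plan (`t12_logLinearPreimage_and_dipoleModulus`, §2/§6): this is the law that composes circle
averages (FF2) and reduces zonal kernels to one-dimensional integrals with the angular profile retained
(Funk–Hecke for circles, Z5). [folklore] -/
theorem t12_sphereMeasure_cyl : ∀ n : EuclideanSpace ℝ (Fin 3), ‖n‖ = 1 → ∀ F : EuclideanSpace ℝ (Fin 3) → ENNReal, Measurable F → ∫⁻ ν : Metric.sphere (0 : EuclideanSpace ℝ (Fin 3)) 1, F (ν : EuclideanSpace ℝ (Fin 3)) ∂Literature.MathematicalPhysics.KineticTheory.sphereMeasure = ∫⁻ z in Set.Ioo (-1 : ℝ) 1, ∫⁻ φ in Set.Ioo (-Real.pi) Real.pi, F (z • n + Real.sqrt (1 - z ^ 2) • (Real.cos φ • Literature.Analysis.FluidPDE.Lambert.e₁ n + Real.sin φ • Literature.Analysis.FluidPDE.Lambert.e₂ n)) :=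
  fun _ hn _ hF => lintegral_sphere_eq_cyl hn hF

/-- **Registered helper `t12_integral_sphere_cyl` — cylindrical coordinates on `S²`, Bochner form.** For a
unit vector `n` of `ℝ³` and `f : ℝ³ → ℝ` measurable and integrable on the unit sphere:
`∫_{S²} f dσ = ∫_{z ∈ (-1,1)} ∫_{φ ∈ (-π,π)} f(z n + √(1-z²)(cos φ e₁ n + sin φ e₂ n)) dφ dz`
(measure identity `sphereMeasure_map_coe_eq_map_cylPoint` + Fubini; Banach-valued version
`integral_sphere_eq_cyl`). [folklore] -/
theorem t12_integral_sphere_cyl : ∀ n : EuclideanSpace ℝ (Fin 3), ‖n‖ = 1 → ∀ f : EuclideanSpace ℝ (Fin 3) → ℝ, Measurable f → MeasureTheory.Integrable (fun ν : Metric.sphere (0 : EuclideanSpace ℝ (Fin 3)) 1 => f (ν : EuclideanSpace ℝ (Fin 3))) Literature.MathematicalPhysics.KineticTheory.sphereMeasure → ∫ ν : Metric.sphere (0 : EuclideanSpace ℝ (Fin 3)) 1, f (ν : EuclideanSpace ℝ (Fin 3)) ∂Literature.MathematicalPhysics.KineticTheory.sphereMeasure = ∫ z in Set.Ioo (-1 :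 ℝ) 1, ∫ φ in Set.Ioo (-Real.pi) Real.pi, f (z • n + Real.sqrt (1 - z ^ 2) • (Real.cos φ • Literature.Analysis.FluidPDE.Lambert.e₁ n + Real.sin φ • Literature.Analysis.FluidPDE.Lambert.e₂ n)) :=
  fun _ hn _ hf hi => integral_sphere_eq_cyl hn hf.stronglyMeasurable hi

end Summit.AtomisticToContinuum.HydrodynamicLimit.Theorems.ClampedCorrectorBirth

end
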